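import Mathlib
import HarnessLib
import Summits.HubbardSuperconductivity.HubbardSuperconductivity.Theses.LiebTwin
import Summits.HubbardSuperconductivity.HubbardSuperconductivity.Theorems.LiebTwinNoOnsiteODLROPseudospinCeiling

/-!
# Crux `NoOnsiteODLRO` (stmt-HubbardSuperconductivity-0933) — registered stub `stub_pseudospinOnsiteCeiling`
# of line `registered` (lead c2): the pseudospin on-site ceiling, in the lead's registered shape

Census by-product B3 of crux `NoOnsiteODLRO`: for the Hubbard torus `H = hubbardTorus 2 L 1 U` on `(ℤ/Lℤ)²`
with `L` even, EVERY real `U`, and every ground state `ψ` of the joint sector `(N, S^z = 0)`, `2 ≤ N ≤ L²`,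

  `(U - (E(N,0) - E(N-2,0))) · Re⟨ψ, P_sᴴ P_s ψ⟩ ≤ -((L² - N + 2) · Re⟨ψ, T ψ⟩)`,

`P_s = pairField sWave L` the on-site pair field, `T = hubbardTorus 2 L 1 0` the hopping operator,
`E(M,0) = minEnergyOn H (szSector M 0)`. For `w = U - (E(N,0) - E(N-2,0)) ≤ 0` both sides have the right
sign (`Re⟨ψ,Tψ⟩ ≤ 0` by the `f`-sum rule); for `w > 0` the ground state is an `η`-vacuum and Zhang's pseudospin
`SU(2)` (Yang's `[H, η†] = U η†`, the `su(2)` relation `ηη† = η†η - 2η^z`, the `f`-sum rule for the staggered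
density `ρ_Q`, and two applications of the variational principle in the sectors `(N,0)` and `(N-2,0)`) gives
the bound with the Clebsch–Gordan factor `L² - N + 2`.

The operator-level inequality was landed (same crux, `--supports`) by seat
`prover-HubbardSuperconductivity-route-HubbardSuperconductivity-LiebTwin-0` as
`Summit.HubbardSuperconductivity.HubbardSuperconductivity.Theorems.NoOnsiteODLRO.Pseudospin.pseudospinOnsiteCeiling`
(`Theorems/LiebTwinNoOnsiteODLROPseudospinCeiling.lean`, p152768), with the right-hand side written
`(L² - N + 2) · (-Re⟨ψ,Tψ⟩)`. Per the coordination note of lead c2 (whoever lands first is imported by the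
other), this file serves lead c2's REGISTERED signature of the stub — argument order `(U, L)`, the (unused)
normalisation hypothesis `star ψ ⬝ᵥ ψ = 1`, and the right-hand side `-((L² - N + 2) · Re⟨ψ,Tψ⟩)` — by
importing that theorem and moving the sign (`mul_neg`). No definition is introduced; nothing is re-proved.

Sources: S. C. Zhang, PRL 65 (1990) 120; C. N. Yang, PRL 63 (1989) 2144; C. N. Yang, S. C. Zhang,
Mod. Phys. Lett. B 4 (1990) 759; T. Koma, H. Tasaki, J. Stat. Phys. 76 (1994) 745.
-/

noncomputable section

namespace Summit.HubbardSuperconductivity.NoOnsiteODLRO.Pseudospin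

open Matrix Finset
open scoped ComplexOrder
open Literature.Probability.LatticeModels Literature.MathematicalPhysics.QuantumLattice

/-- **Registered stub `stub_pseudospinOnsiteCeiling`** of line `registered` for crux `NoOnsiteODLRO`
(stmt-HubbardSuperconductivity-0933; census by-product B3, NOT a piece of the composition `NoOnsiteODLRO_of`):
the pseudospin on-site ceiling. For the Hubbard torus `H = hubbardTorus 2 L 1 U`, `L` even, every real `U`,
every ground state `ψ` of the joint sector `(N, S^z = 0)` with `2 ≤ N ≤ L²` (the normalisation hypothesis is
not needed and not used):
`(U - (E(N,0) - E(N-2,0))) · Re⟨ψ, P_sᴴ P_s ψ⟩ ≤ -((L² - N + 2) · Re⟨ψ, T ψ⟩)`,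
`P_s = pairField sWave L`, `T = hubbardTorus 2 L 1 0`, `E(M,0) = minEnergyOn H (szSector M 0)`.
Obtained from the landed operator-level ceiling `pseudospinOnsiteCeiling` (p152768) by `a · (-b) = -(a · b)`.
Zhang, PRL 65 (1990) 120; Yang, PRL 63 (1989) 2144; Yang–Zhang, Mod. Phys. Lett. B 4 (1990) 759;
Koma–Tasaki, J. Stat. Phys. 76 (1994) 745. [folklore] -/
theorem stub_pseudospinOnsiteCeiling :
    ∀ (U : ℝ) (L : ℕ) [NeZero L], Even L →
      ∀ (N : ℕ) (ψ : Fock (Orb (FermionTorus 2 L))), 2 ≤ N → N ≤ L ^ 2 → star ψ ⬝ᵥ ψ = 1 →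
        IsGroundStateInSector (hubbardTorus 2 L 1 U) N 0 ψ →
        (U - ((hubbardTorus 2 L 1 U).minEnergyOn (szSector (Λ := FermionTorus 2 L) N 0) -
              (hubbardTorus 2 L 1 U).minEnergyOn (szSector (Λ := FermionTorus 2 L) (N - 2) 0))) *
            (expect ((pairField sWave L)ᴴ * pairField sWave L) ψ).re ≤
          -(((L : ℝ) ^ 2 - N + 2) * (expect (hubbardTorus 2 L 1 0) ψ).re) := by
  intro U L _ hL N ψ hN hNL _ hψ
  rw [← mul_neg]
  exact Summit.HubbardSuperconductivity.HubbardSuperconductivity.Theorems.NoOnsiteODLRO.Pseudospin.pseudospinOnsiteCeiling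
    hL U hN hNL hψ

end Summit.HubbardSuperconductivity.NoOnsiteODLRO.Pseudospin

end
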